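import Literature.NumberTheory.EllipticCurves.SemilinearLocalCohomology
import HarnessLib

/-!
# T1 JET (cell `bsd-jet`), road K, stub S1 ↔ self-duality bridge: NATURALITY of the semilinear
# (outer Galois) actions in the module — `σ_*` commutes with `H^d(f)` for intertwining maps `f`
# compatible with the semilinear endomorphisms

HONEST FRAMING (programme file `BSD-LIT2PART-PROGRAMME-v1.md` §HONESTY, verbatim): «no tranche here
proves BSD; ARM L moves the LITERAL column of an r ≤ 1 census into the kernel-proved-modulo-named-print
column; ARM P changes what «named print» is worth.» THEOREMS ONLY (seat `bsd-jet-pv-1`, session g4;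
`--supports stmt-BirchSwinnertonDyer-14418`, helper): no definition, no named fact, no `sorry`.
Nothing is booked; 0 classes move.

## What

For a continuous `Γ_K`-intertwining map `f : M → M'` of discrete Galois modules and `τ`-semilinear
`ψ` on `M`, `ψ'` on `M'` with `f ∘ ψ = ψ' ∘ f`:
* `map_semilinearH` — `H^d(f) (σ_* c) = σ_* (H^d(f) c)` on `H^d(K, ·)` (`semilinearH`);
* `map_semilinearLocalH` — the same on `H^d(Γ_E, ·) → H^d(Γ_{E'}, ·)` (`semilinearLocalH`,
  `f.restrictField`).
Purpose: with `f` the Weil transport `E[n] → E[n]^D` (tree `weilDualIntertwining`, X11b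
`WeilTransport`), `ψ = τ` on points and `ψ' = (g ↦ τ ∘ g ∘ τ⁻¹)` (`tateDualTorsionSemilinearMap`), the
hypothesis `f ∘ ψ = ψ' ∘ f` is the equivariance `τ e(S, T) = e(τS, τT)` of the Weil pairing under the
lift `τ`, and the conclusions identify `conjAct` with `conjActDual` (and `conjActPlace` with
`conjActPlaceDual`) across the self-duality `E[n] ≅ E[n]^D` — the bridge between the signed counting
in `H¹(K, E[n]^D)`-currency (`Rank1ResidualJetSignedGlobalDuality`) and the `H¹(K, E[n])`-currency of
`JET.tamagawaExponent_le_mInfty_of_rowData`. Both by `ContinuousCohomology.map_comp` twice and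
`map_congr_of_eq`. References (locators only): [cite: NeukirchSchmidtWingberg2008, I §5]
[cite: SilvermanAEC2009, Prop. III.8.1 (d)] [cite: Jetchev2008, §5 Thm. 5.1].
Design: no definitions. Axioms: `propext`, `Classical.choice`, `Quot.sound`.
-/

set_option autoImplicit false

noncomputable section

open scoped Classical ContRepresentation
open Field CategoryTheory
open Literature.NumberTheory.EllipticCurves Literature.NumberTheory.GaloisRepresentations

universe u v

namespace Summit.BirchSwinnertonDyer.Rank1Residual.JET.GlobalDuality

section Naturality

variable {k : Type v} {K : Type u} [Field k] [Field K] [Algebra k K]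
variable {M M' : Type u} [AddCommGroup M] [TopologicalSpace M] [DiscreteTopology M]
  [AddCommGroup M'] [TopologicalSpace M'] [DiscreteTopology M']
variable {ρ : DiscreteGaloisModule K M} {ρ' : DiscreteGaloisModule K M'}
  {σ : K ≃ₐ[k] K} {τ : AlgebraicClosure K ≃+* AlgebraicClosure K}

/-- **`H^d(f)` commutes with the global semilinear action** when `f ∘ ψ = ψ' ∘ f`.
[cite: NeukirchSchmidtWingberg2008, I §5] -/
theorem map_semilinearH (hτ : IsLiftOfAut σ τ)
    (f : ρ.toContRepresentation →ⁱL ρ'.toContRepresentation)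
    {ψ : M →+ M} (hψ : IsSemilinear ρ hτ ψ) {ψ' : M' →+ M'} (hψ' : IsSemilinear ρ' hτ ψ')
    (hf : ∀ m, f (ψ m) = ψ' (f m)) (d : ℕ) (c : galoisCohomology ρ d) :
    galoisCohomology.map f d (semilinearH hτ ψ hψ d c) =
      semilinearH hτ ψ' hψ' d (galoisCohomology.map f d c) := by
  have hcomp : ContinuousCohomology.map hτ.conjGalCMH (semilinearHom hτ ψ hψ) d ≫
      ContinuousCohomology.map (ContinuousMonoidHom.id _) (X := ρ.toTopRep) (Y := ρ'.toTopRep)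
        (TopRep.ofHom ⟨f.toContinuousLinearMap, f.isIntertwining'⟩) d =
      ContinuousCohomology.map (ContinuousMonoidHom.id _) (X := ρ.toTopRep) (Y := ρ'.toTopRep)
        (TopRep.ofHom ⟨f.toContinuousLinearMap, f.isIntertwining'⟩) d ≫
        ContinuousCohomology.map hτ.conjGalCMH (semilinearHom hτ ψ' hψ') d := by
    rw [← ContinuousCohomology.map_comp, ← ContinuousCohomology.map_comp]
    exact map_congr_of_eq (X := ρ.toTopRep) (Y := ρ'.toTopRep)
      (φ := hτ.conjGalCMH.comp (ContinuousMonoidHom.id _))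
      (φ' := (ContinuousMonoidHom.id _).comp hτ.conjGalCMH) (by ext; rfl) _ _ (fun m => hf m) d
  have happ := congrArg (fun T => TopModuleCat.Hom.hom T c) hcomp
  simp only [TopModuleCat.hom_comp, ContinuousLinearMap.comp_apply] at happ
  exact happ

end Naturality

section LocalNaturality

variable {K : Type u} [Field K] [CharZero K]
variable {M M' : Type u} [AddCommGroup M] [TopologicalSpace M] [DiscreteTopology M]
  [AddCommGroup M'] [TopologicalSpace M'] [DiscreteTopology M']
variable {ρ : DiscreteGaloisModule K M} {ρ' : DiscreteGaloisModule K M'}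
variable {E E' : Type u} [Field E] [Algebra K E] [Field E'] [Algebra K E']
variable {σ : K ≃ₐ[ℚ] K} {τ : AlgebraicClosure K ≃+* AlgebraicClosure K} {θ : E ≃+* E'}
  {Θ : AlgebraicClosure E ≃+* AlgebraicClosure E'}

/-- **`H^d(f|_{Γ_E})` commutes with the local semilinear action** when `f ∘ ψ = ψ' ∘ f`:
`H^d(f|_{Γ_{E'}}) (σ_* c) = σ_* (H^d(f|_{Γ_E}) c)`. [cite: NeukirchSchmidtWingberg2008, I §5] -/
theorem map_semilinearLocalH (hτ : IsLiftOfAut σ τ) (hΘ : IsLiftOfRingEquiv θ Θ)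
    (hc : LiftsCommute τ Θ) (f : ρ.toContRepresentation →ⁱL ρ'.toContRepresentation)
    {ψ : M →+ M} (hψ : IsSemilinear ρ hτ ψ) {ψ' : M' →+ M'} (hψ' : IsSemilinear ρ' hτ ψ')
    (hf : ∀ m, f (ψ m) = ψ' (f m)) (d : ℕ)
    (c : galoisCohomology (GaloisRep.restrictField E ρ) d) :
    galoisCohomology.map (f.restrictField E') d (semilinearLocalH hτ hΘ hc ψ hψ d c) =
      semilinearLocalH hτ hΘ hc ψ' hψ' d (galoisCohomology.map (f.restrictField E) d c) := by
  have hcomp : ContinuousCohomology.map hΘ.conjGalCMH (semilinearLocalHom hτ hΘ hc ψ hψ) d ≫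
      ContinuousCohomology.map (ContinuousMonoidHom.id _)
        (X := DiscreteGaloisModule.toTopRep (GaloisRep.restrictField E' ρ))
        (Y := DiscreteGaloisModule.toTopRep (GaloisRep.restrictField E' ρ'))
        (TopRep.ofHom ⟨(f.restrictField E').toContinuousLinearMap,
          (f.restrictField E').isIntertwining'⟩) d =
      ContinuousCohomology.map (ContinuousMonoidHom.id _)
        (X := DiscreteGaloisModule.toTopRep (GaloisRep.restrictField E ρ))
        (Y := DiscreteGaloisModule.toTopRep (GaloisRep.restrictField E ρ'))
        (TopRep.ofHom ⟨(f.restrictField E).toContinuousLinearMap,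
          (f.restrictField E).isIntertwining'⟩) d ≫
        ContinuousCohomology.map hΘ.conjGalCMH (semilinearLocalHom hτ hΘ hc ψ' hψ') d := by
    rw [← ContinuousCohomology.map_comp, ← ContinuousCohomology.map_comp]
    exact map_congr_of_eq (X := DiscreteGaloisModule.toTopRep (GaloisRep.restrictField E ρ))
      (Y := DiscreteGaloisModule.toTopRep (GaloisRep.restrictField E' ρ'))
      (φ := hΘ.conjGalCMH.comp (ContinuousMonoidHom.id _))
      (φ' := (ContinuousMonoidHom.id _).comp hΘ.conjGalCMH) (by ext; rfl) _ _ (fun m => hf m) d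
  have happ := congrArg (fun T => TopModuleCat.Hom.hom T c) hcomp
  simp only [TopModuleCat.hom_comp, ContinuousLinearMap.comp_apply] at happ
  exact happ

end LocalNaturality

end Summit.BirchSwinnertonDyer.Rank1Residual.JET.GlobalDuality

end
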